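import Summits.Ventures.HSemireg.SiegelComponentChart
import Summits.Ventures.HSemireg.ComponentTransferSheaf
import HarnessLib

/-!
# Venture HSemireg — the chain on `𝒜_{g,δ,N}` for a VECTOR-BUNDLE representative (Buchweitz–Flenner door): composition of
# theory seat 3's `SiegelComponentChart.lean` (chart assumption) with `ComponentTransferSheaf.lean` (BF Thm. 5.1 on a chart)

HONEST FRAMING. Assembly file of the computation cell `pub-hsemireg` (Lean seat p3, composition duty); nothing is claimed
about any variety and nothing here says that HC / HC_CM / HC_AV holds — every theorem carries its inputs BY NAME. The
𝒜_g-form of the chain was landed by th-3 for an INTEGRAL lci representative (`hc_on_siegelComponent_of_semiregular_of_smul_add`)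
and by p3 for the reducible / arbitrary lci doors (`SiegelComponentChartReducible.lean`). This file adds the SHEAF door: the
representative at the special point `(t₀, α₀)` of the component `C` is a finite locally free `I`-semiregular `ℰ₀`
(`IsISemiregular`, the tree's REAL partial semiregularity map `σ_I` on Mathlib's `Ext`), given — as in `SheafSeed.lean` —
on EVERY model `X₀ ≅ 𝒴_{t₀}` of the special fibre (so that it can be placed on the chart fibre without transporting sheaves
along isomorphisms), with `ch_p(ℰ₀) = a·α₀ + b·Λ_p|_{t₀}` (`a ≠ 0`) and `ch_{p'}(ℰ₀) = c_{p'}·Λ_{p'}|_{t₀}` for the other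
`p' ∈ I`, where the `Λ_{p'}` are global classes of the universal family, fibrewise of type `(p',p')` (powers of the relative
polarisation) and `Λ_p` fibrewise rational and algebraic. Transport fact: `BuchweitzFlenner2003_variationalHodge_ISemiregular`
(BF Thm. 5.1, finite locally free `ℰ₀`, general finite `I`; REFEREED named fact). Chart: `SiegelHodgeLocusChart g δ N`
(th-3's ASSEMBLED assumption, BY NAME).

* `hc_on_siegelComponent_of_sheafSeed_of_smul_add` — the theorem. Proof: th-3's chart `(f, Φ, W)`; the seed on the chart
  fibre `𝒳_{u₀}` through `e₀ : 𝒳_{u₀} ≅ 𝒴_{t₀}`; the companion global classes `W_{p'} := c_{p'}·Φ^*Λ_{p'}` (`p' ≠ p`),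
  `W_p := a·W + b·Φ^*Λ_p` (a dependent `Function.update`); th-3's `forall_mem_algebraicClasses_of_sweepsClasses_sheaf_of_smul_add`.

References: [BuchweitzFlenner2003] §5 Thm. 5.1; [CattaniDeligneKaplan1995JAMS] Thm. 1.1, Cor. 1.2; [Markman2025SecantWeil]
§1.5 (the shape `q·hⁿ + w`); [Bloch1972Semiregularity] proof of (7.4), p. 65 (countable-union step).
-/

noncomputable section

open CategoryTheory AlgebraicGeometry Set
open Literature.AlgebraicGeometry.Motives Literature.AlgebraicGeometry.HodgeTheory
open Literature.AlgebraicGeometry.ModuliOfAbelianVarieties Literature.AlgebraicGeometry.Deligne1982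
open Literature.AlgebraicTopology.SingularHomology

namespace Summit.Ventures.HSemireg

local notation3 (prettyPrint := false) "Res[" f ", " s ", " k ", " A "]" =>
  complexBetti.map (Literature.AlgebraicGeometry.Motives.fiberι f s) k A

section Siegel

variable {g : ℕ} {δ : Fin g → ℕ} {N : ℕ}

/-- **The chain on 𝒜_{g,δ,N}, Remark (7.5) form, for an `I`-semiregular VECTOR BUNDLE** (Buchweitz–Flenner door). Granted
`SiegelHodgeLocusChart g δ N` and `BuchweitzFlenner2003_variationalHodge_ISemiregular` (BF Thm. 5.1, refereed), a Chern
character theory `Cc`, a finite set `I ∋ p` of Chern degrees, global classes `Λ_{p'}` of the universal family fibrewise of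
type `(p',p')` for `p' ∈ I` with `Λ_p` moreover fibrewise rational and algebraic, a component `C` of the locus of Hodge
classes, a point `(t₀, α₀) ∈ C`, rationals `a ≠ 0`, `b`, `c_{p'}`, and — on EVERY model `e : X₀ ≅ 𝒴_{t₀}` — a finite locally
free `ℰ₀` on `X₀`, `I`-semiregular (`σ_I` injective), with `ch_p(ℰ₀) = e^*(a·α₀ + b·Λ_p|_{t₀})` and
`ch_{p'}(ℰ₀) = e^*(c_{p'}·Λ_{p'}|_{t₀})` (`p' ∈ I`, `p' ≠ p`): then `α` is algebraic for EVERY `(t, α) ∈ C`. For the cell: `g = 2n`,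
`p = n`, `α₀ = w` a Weil class, `Λ_{p'} = θ^{p'}`, `I = {1, …, n}` — the `HasBFSheafSeedAt` shape on the universal family.
[cite: BuchweitzFlenner2003, §5 Thm. 5.1] [cite: CattaniDeligneKaplan1995JAMS, Thm. 1.1 and Cor. 1.2]
[cite: Markman2025SecantWeil, §1.5] -/
theorem hc_on_siegelComponent_of_sheafSeed_of_smul_add (hA : SiegelHodgeLocusChart g δ N) {p : ℕ}
    (hBF : BuchweitzFlenner2003_variationalHodge_ISemiregular) (Cc : ChernCharacterBetti)
    (D : SiegelModuliDatum g δ N) (C : HodgeLocusComponent D.f g p) (I : Finset ℕ) (hp : p ∈ I)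
    (Λ : (p' : ℕ) → complexBetti D.𝒳 (2 * p'))
    (hΛ : ∀ p' ∈ I, ∀ s : ComplexPoints D.S, IsOfHodgeType g (fiberOver D.f s) (2 * p') p' p' (Res[D.f, s, 2 * p', Λ p']))
    (hΛp : ∀ s : ComplexPoints D.S, IsRationalClass (Res[D.f, s, 2 * p, Λ p]) ∧
      Res[D.f, s, 2 * p, Λ p] ∈ algebraicClasses (fiberOver D.f s) p)
    {x₀ : FiberClass D.f (2 * p)} (hx₀ : x₀ ∈ C.carrier) (a b : ℚ) (ha : a ≠ 0) (c : ℕ → ℚ)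
    (hseed : ∀ (X₀ : SchemeOver ℂ) (e : X₀ ≅ fiberOver D.f x₀.pt),
      ∃ (E₀ : X₀.left.Modules) (hE₀ : IsFiniteLocallyFree E₀), IsISemiregular hE₀ {q | q + 1 ∈ I} ∧
        Cc.ch X₀ E₀ p = complexBetti.map e.hom (2 * p) ((a : ℂ) • x₀.cls + (b : ℂ) • Res[D.f, x₀.pt, 2 * p, Λ p]) ∧
        ∀ p' ∈ I, p' ≠ p →
          Cc.ch X₀ E₀ p' = complexBetti.map e.hom (2 * p') (((c p' : ℚ) : ℂ) • Res[D.f, x₀.pt, 2 * p', Λ p'])) :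
    ∀ x ∈ C.carrier, x.cls ∈ algebraicClasses (fiberOver D.f x.pt) p := by
  obtain ⟨𝒳, T, f, Φ, W, hf, h𝒳, hT, hTs, hTi, hW, hΦ, hsw⟩ := hA D p C
  haveI := hTi
  -- the pulled-back companion classes `L_{p'} = Φ^*Λ_{p'}`: fibrewise `(p',p')`, and `L_p` algebraic on every chart fibre
  have hLfib : ∀ p' ∈ I, ∀ u : ComplexPoints T,
      IsOfHodgeType g (fiberOver f u) (2 * p') p' p' (Res[f, u, 2 * p', complexBetti.map Φ (2 * p') (Λ p')]) := by
    intro p' hp' u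
    obtain ⟨s, e, he⟩ := hΦ u
    rw [← map_res_eq_res_map_of_comm e he]
    exact (isOfHodgeType_map_iff_of_iso e).2 (hΛ p' hp' s)
  have hLalg : ∀ u : ComplexPoints T,
      Res[f, u, 2 * p, complexBetti.map Φ (2 * p) (Λ p)] ∈ algebraicClasses (fiberOver f u) p := by
    intro u
    obtain ⟨s, e, he⟩ := hΦ u
    rw [← map_res_eq_res_map_of_comm e he]
    exact (mem_algebraicClasses_map_iff_of_iso e).2 (hΛp s).2
  -- the special point on the chart and the sheaf seed on the chart fibre
  obtain ⟨u₀, e₀, he₀Φ, he₀⟩ := hsw x₀ hx₀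
  obtain ⟨E₀, hE₀, hsr, hchp, hchp'⟩ := hseed (fiberOver f u₀) e₀
  -- the global classes of the chart in the degrees `p' ∈ I`
  let Wfam : (p' : ℕ) → complexBetti 𝒳 (2 * p') :=
    Function.update (fun p' => ((c p' : ℚ) : ℂ) • complexBetti.map Φ (2 * p') (Λ p')) p
      ((a : ℂ) • W + (b : ℂ) • complexBetti.map Φ (2 * p) (Λ p))
  have hWp : Wfam p = (a : ℂ) • W + (b : ℂ) • complexBetti.map Φ (2 * p) (Λ p) := Function.update_self _ _ _
  have hWne : ∀ p', p' ≠ p → Wfam p' = ((c p' : ℚ) : ℂ) • complexBetti.map Φ (2 * p') (Λ p') :=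
    fun p' hne => Function.update_of_ne hne _ _
  have hWhodge : ∀ p' ∈ I, ∀ u : ComplexPoints T,
      IsOfHodgeType g (fiberOver f u) (2 * p') p' p' (Res[f, u, 2 * p', Wfam p']) := by
    intro p' hp' u
    rcases eq_or_ne p' p with rfl | hne
    · rw [hWp, map_add, map_smul, map_smul]
      exact ((hW u).2.smul (a : ℂ)).add (hf.isSmoothProjective u) ((hLfib p' hp u).smul (b : ℂ))
    · rw [hWne p' hne, map_smul]
      exact (hLfib p' hp' u).smul _
  have hW₀ : ∀ p' ∈ I, Res[f, u₀, 2 * p', Wfam p'] = Cc.ch (fiberOver f u₀) E₀ p' := by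
    intro p' hp'
    rcases eq_or_ne p' p with rfl | hne
    · rw [hWp, map_add, map_smul, map_smul, hchp, map_add, map_smul, map_smul, he₀, map_res_eq_res_map_of_comm e₀ he₀Φ]
    · rw [hWne p' hne, map_smul, hchp' p' hp' hne, map_smul, map_res_eq_res_map_of_comm e₀ he₀Φ]
  have hsweep : SweepsClasses D.f f W C.carrier := fun x hx => by
    obtain ⟨u, e, -, he⟩ := hsw x hx
    exact ⟨u, e, he⟩
  exact forall_mem_algebraicClasses_of_sweepsClasses_sheaf_of_smul_add hBF Cc hf h𝒳 hT hTs u₀ E₀ hE₀ I hsr Wfam hWhodge hW₀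
    hp W (complexBetti.map Φ (2 * p) (Λ p)) a b ha hWp hLalg hsweep

end Siegel

end Summit.Ventures.HSemireg

end
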